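import Literature.AnabelianGeometry.AbsoluteAnabelian.HolomorphicEllipticCuspidalization
import Literature.AnabelianGeometry.AbsoluteAnabelian.AutHolomorphicSpacesFiniteEtaleProofs
import HarnessLib

/-!
# [AbsTopIII] Cor 2.7 (b), sub-node (b).8 — part 1: the extension `h̄` of `cov ∘ imm⁻¹` over the cusps

PROOF-ONLY companion (no new definitions, no new named facts) of
`HolomorphicEllipticCuspidalization.lean` (p414370, seat abc-iut-L4-t12; sub-DAG
`plan/L4/SUBDAG-AbsTopIII-Cor-27.md`, row Cor-27.b.r10 (b).8), seat abc-iut-w5-d053.  S. Mochizuki,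
*Topics in absolute anabelian geometry III*, §2, Corollary 2.7 (b), kurims p. 59: for an elliptic
cuspidalization diagram `E ↩ U → E`, `U → E` is "an abelian finite étale covering [which necessarily
extends to a covering of the one-point compactification of `E^top`]; `E^top ↩ U^top` is an open
immersion whose image is the complement of a finite subset of `E^top`".

For a diagram `D : EllipticCuspidalizationDiagram 𝔼` over the punctured complex torus
`𝔼 = puncturedTorus Φ = T ∖ {0}` we study the map `h̄ : T → T` equal to `D.cov ∘ D.imm⁻¹` on the open
`imm(𝕌) ⊆ 𝔼 ⊆ T` and to `0` elsewhere, written throughout as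
`Function.extend (val ∘ D.imm) (val ∘ D.cov) 0` (no definition is introduced):

* `isOpenEmbedding_coe_imm` — `𝕌 ↪ 𝔼 ↪ T` is an open embedding;
* `extend_cov_apply_imm`, `extend_cov_apply_of_not_mem`, `extend_cov_ne_zero_iff`, `extend_cov_zero`;
* `finite_compl_range_coe_imm` — `T ∖ imm(𝕌)` is finite; `finite_preimage_extend_cov` — `h̄` has
  finite fibres over finite sets;
* `continuous_extend_cov` — **`h̄` is continuous** (`cov` is proper: the tree's
  `IsFiniteEtale.isProperMap`; near its finitely many exceptional points `h̄ → 0`, `T` being the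
  one-point compactification of `𝔼` at `0`);
* `exists_injOn_extend_cov` — `h̄` is injective near each point of `imm(𝕌)` (`cov` étale).

Part 2 (`HolomorphicEllipticCuspidalizationTorsionProofs.lean`) adds holomorphy and concludes (b).8.
Refereed pre-IUT material; nothing here bears on the disputed [IUTchIII] Cor. 3.12; no side taken.
-/

noncomputable section

namespace Literature.AnabelianGeometry.AbsoluteAnabelian

namespace HolomorphicEllipticCuspidalization

open _root_.TopologicalSpace _root_.Topology _root_.Set _root_.Function _root_.Filter
open scoped _root_.Manifold _root_.ContDiff
open Literature.Geometry.Kaehler (ComplexTorus)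

section Diagram

variable {ι : Type} [Fintype ι] {Φ : (ι → ℝ) ≃L[ℝ] ℂ}
  (D : EllipticCuspidalizationDiagram ↥(puncturedTorus Φ))

/-! ### The open embedding `𝕌 ↪ 𝔼 ⊆ T` and the extension by `0` of `cov ∘ imm⁻¹` -/

/-- `𝕌 ↪ 𝔼 ↪ T` is an open embedding. [cite: MochizukiAbsTopIII2015, Corollary 2.7 (b) p.59] -/
theorem isOpenEmbedding_coe_imm :
    IsOpenEmbedding (fun u : D.U => ((D.imm u : ↥(puncturedTorus Φ)) : ComplexTorus Φ)) :=
  (puncturedTorus Φ).isOpenEmbedding'.comp D.imm_openEmbedding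

/-- The extension `h̄ : T → T` of `cov ∘ imm⁻¹` by `0` agrees with `cov` on `imm(u)`.
[cite: MochizukiAbsTopIII2015, Corollary 2.7 (b) p.59] -/
theorem extend_cov_apply_imm (u : D.U) :
    Function.extend (fun u : D.U => ((D.imm u : ↥(puncturedTorus Φ)) : ComplexTorus Φ))
        (fun u => ((D.cov u : ↥(puncturedTorus Φ)) : ComplexTorus Φ)) (fun _ => 0)
        ((D.imm u : ↥(puncturedTorus Φ)) : ComplexTorus Φ) =
      ((D.cov u : ↥(puncturedTorus Φ)) : ComplexTorus Φ) :=
  (isOpenEmbedding_coe_imm D).injective.extend_apply _ _ u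

/-- Off the image of `𝕌`, the extension `h̄` is `0`. [cite: MochizukiAbsTopIII2015, Corollary 2.7 (b) p.59] -/
theorem extend_cov_apply_of_not_mem {t : ComplexTorus Φ}
    (ht : t ∉ Set.range (fun u : D.U => ((D.imm u : ↥(puncturedTorus Φ)) : ComplexTorus Φ))) :
    Function.extend (fun u : D.U => ((D.imm u : ↥(puncturedTorus Φ)) : ComplexTorus Φ))
        (fun u => ((D.cov u : ↥(puncturedTorus Φ)) : ComplexTorus Φ)) (fun _ => 0) t = 0 := by
  rw [Function.extend_apply']
  exact fun ⟨u, hu⟩ => ht ⟨u, hu⟩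

/-- `h̄ t ≠ 0` exactly on the image of `𝕌` (`cov` lands in `𝔼 = T ∖ {0}`).
[cite: MochizukiAbsTopIII2015, Corollary 2.7 (b) p.59] -/
theorem extend_cov_ne_zero_iff (t : ComplexTorus Φ) :
    Function.extend (fun u : D.U => ((D.imm u : ↥(puncturedTorus Φ)) : ComplexTorus Φ))
        (fun u => ((D.cov u : ↥(puncturedTorus Φ)) : ComplexTorus Φ)) (fun _ => 0) t ≠ 0 ↔
      t ∈ Set.range (fun u : D.U => ((D.imm u : ↥(puncturedTorus Φ)) : ComplexTorus Φ)) := by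
  constructor
  · intro h
    by_contra ht
    exact h (extend_cov_apply_of_not_mem D ht)
  · rintro ⟨u, rfl⟩
    rw [extend_cov_apply_imm]
    exact (mem_puncturedTorus_iff Φ _).1 (D.cov u).2

/-- `h̄ 0 = 0`. [cite: MochizukiAbsTopIII2015, Corollary 2.7 (b) p.59] -/
theorem extend_cov_zero :
    Function.extend (fun u : D.U => ((D.imm u : ↥(puncturedTorus Φ)) : ComplexTorus Φ))
        (fun u => ((D.cov u : ↥(puncturedTorus Φ)) : ComplexTorus Φ)) (fun _ => 0) 0 = 0 := by
  refine extend_cov_apply_of_not_mem D ?_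
  rintro ⟨u, hu⟩
  exact (mem_puncturedTorus_iff Φ _).1 (D.imm u).2 hu

/-- The complement of the image of `𝕌` in `T` is finite: it is `{0}` together with the finitely many
cuspidal points of the diagram ("the complement of a finite subset of `E^top`").
[cite: MochizukiAbsTopIII2015, Corollary 2.7 (b) p.59] -/
theorem finite_compl_range_coe_imm :
    (Set.range (fun u : D.U => ((D.imm u : ↥(puncturedTorus Φ)) : ComplexTorus Φ)))ᶜ.Finite := by
  refine ((Set.finite_singleton (0 : ComplexTorus Φ)).union
    (D.imm_cofinite.image (Subtype.val : ↥(puncturedTorus Φ) → ComplexTorus Φ))).subset ?_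
  intro t ht
  by_cases h0 : t = 0
  · exact Or.inl h0
  · refine Or.inr ⟨⟨t, (mem_puncturedTorus_iff Φ t).2 h0⟩, ?_, rfl⟩
    rintro ⟨u, hu⟩
    exact ht ⟨u, by show ((D.imm u : ↥(puncturedTorus Φ)) : ComplexTorus Φ) = t; rw [hu]⟩

/-- `h̄` has finite fibres over finite sets (finite fibres of `cov`, cofiniteness of `imm`).
[cite: MochizukiAbsTopIII2015, Corollary 2.7 (b) p.59] -/
theorem finite_preimage_extend_cov {s : Set (ComplexTorus Φ)} (hs : s.Finite) :
    (Function.extend (fun u : D.U => ((D.imm u : ↥(puncturedTorus Φ)) : ComplexTorus Φ))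
        (fun u => ((D.cov u : ↥(puncturedTorus Φ)) : ComplexTorus Φ)) (fun _ => 0) ⁻¹' s).Finite := by
  classical
  have hfib : ((fun u : D.U => ((D.cov u : ↥(puncturedTorus Φ)) : ComplexTorus Φ)) ⁻¹' s).Finite := by
    refine hs.preimage' fun p _ => ?_
    by_cases hp : p ∈ puncturedTorus Φ
    · refine (D.cov_finiteEtale.finite_fibre ⟨p, hp⟩).subset ?_
      intro u hu
      exact Subtype.ext hu
    · convert Set.finite_empty
      ext u
      simp only [Set.mem_preimage, Set.mem_singleton_iff, Set.mem_empty_iff_false, iff_false]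
      intro hu
      exact hp (hu ▸ (D.cov u).2)
  refine ((finite_compl_range_coe_imm D).union
    (hfib.image (fun u : D.U => ((D.imm u : ↥(puncturedTorus Φ)) : ComplexTorus Φ)))).subset ?_
  intro t ht
  by_cases htr : t ∈ Set.range (fun u : D.U => ((D.imm u : ↥(puncturedTorus Φ)) : ComplexTorus Φ))
  · obtain ⟨u, rfl⟩ := htr
    refine Or.inr ⟨u, ?_, rfl⟩
    rw [Set.mem_preimage, extend_cov_apply_imm] at ht
    exact ht
  · exact Or.inl htr

/-- **`h̄` is continuous**: on the image of `𝕌` it is `cov ∘ imm⁻¹`; at the finitely many other points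
it tends to `0`, because `cov` is proper (finite étale) and `T` is the one-point compactification of `𝔼`
near `0` — "[which necessarily extends to a covering of the one-point compactification of `E^top`]".
[cite: MochizukiAbsTopIII2015, Corollary 2.7 (b) p.59] -/
theorem continuous_extend_cov :
    Continuous (Function.extend (fun u : D.U => ((D.imm u : ↥(puncturedTorus Φ)) : ComplexTorus Φ))
        (fun u => ((D.cov u : ↥(puncturedTorus Φ)) : ComplexTorus Φ)) (fun _ => 0)) := by
  set ι₁ := (fun u : D.U => ((D.imm u : ↥(puncturedTorus Φ)) : ComplexTorus Φ)) with hι₁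
  set hbar := Function.extend ι₁ (fun u => ((D.cov u : ↥(puncturedTorus Φ)) : ComplexTorus Φ))
    (fun _ => 0) with hhbar
  have he : IsOpenEmbedding ι₁ := isOpenEmbedding_coe_imm D
  rw [continuous_iff_continuousAt]
  intro t
  by_cases ht : t ∈ Set.range ι₁
  · obtain ⟨u, rfl⟩ := ht
    refine (he.continuousAt_iff).1 ?_
    have hcomp : hbar ∘ ι₁ = fun u => ((D.cov u : ↥(puncturedTorus Φ)) : ComplexTorus Φ) :=
      funext fun u => extend_cov_apply_imm D u
    rw [hcomp]
    exact (continuous_subtype_val.comp D.cov_finiteEtale.isCoveringMap.continuous).continuousAt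
  · -- at a point off the image: `hbar t = 0` and `hbar → 0`
    have h0 : hbar t = 0 := extend_cov_apply_of_not_mem D ht
    rw [ContinuousAt, h0, (nhds_basis_opens (0 : ComplexTorus Φ)).tendsto_right_iff]
    rintro W ⟨h0W, hWo⟩
    -- `C := Wᶜ` is compact and contained in `𝔼`
    have hC : IsCompact Wᶜ := hWo.isClosed_compl.isCompact
    have hCsub : Wᶜ ⊆ Set.range (Subtype.val : ↥(puncturedTorus Φ) → ComplexTorus Φ) := by
      intro c hc
      refine ⟨⟨c, (mem_puncturedTorus_iff Φ c).2 ?_⟩, rfl⟩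
      rintro rfl
      exact hc h0W
    have hC' : IsCompact ((Subtype.val : ↥(puncturedTorus Φ) → ComplexTorus Φ) ⁻¹' Wᶜ) :=
      Topology.IsInducing.subtypeVal.isCompact_preimage' hC hCsub
    have hK₁ : IsCompact (D.cov ⁻¹' ((Subtype.val : ↥(puncturedTorus Φ) → ComplexTorus Φ) ⁻¹' Wᶜ)) :=
      D.cov_finiteEtale.isProperMap.isCompact_preimage hC'
    have hK₂ : IsCompact (ι₁ '' (D.cov ⁻¹'
        ((Subtype.val : ↥(puncturedTorus Φ) → ComplexTorus Φ) ⁻¹' Wᶜ))) := hK₁.image he.continuous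
    have htK₂ : t ∉ ι₁ '' (D.cov ⁻¹' ((Subtype.val : ↥(puncturedTorus Φ) → ComplexTorus Φ) ⁻¹' Wᶜ)) :=
      fun ⟨u, _, hu⟩ => ht ⟨u, hu⟩
    filter_upwards [hK₂.isClosed.compl_mem_nhds htK₂] with s hs
    by_cases hsr : s ∈ Set.range ι₁
    · obtain ⟨u, rfl⟩ := hsr
      rw [show hbar (ι₁ u) = ((D.cov u : ↥(puncturedTorus Φ)) : ComplexTorus Φ) from
        extend_cov_apply_imm D u]
      by_contra hW
      exact hs ⟨u, hW, rfl⟩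
    · rw [show hbar s = 0 from extend_cov_apply_of_not_mem D hsr]
      exact h0W

/-- **`h̄` is injective near every point of the image of `𝕌`** (`cov` is étale, `imm` an open
embedding). [cite: MochizukiAbsTopIII2015, Corollary 2.7 (b) p.59] -/
theorem exists_injOn_extend_cov (u : D.U) :
    ∃ N : Set (ComplexTorus Φ), IsOpen N ∧ ((D.imm u : ↥(puncturedTorus Φ)) : ComplexTorus Φ) ∈ N ∧
      Set.InjOn (Function.extend (fun u : D.U => ((D.imm u : ↥(puncturedTorus Φ)) : ComplexTorus Φ))
        (fun u => ((D.cov u : ↥(puncturedTorus Φ)) : ComplexTorus Φ)) (fun _ => 0)) N := by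
  have he : IsOpenEmbedding (fun u : D.U => ((D.imm u : ↥(puncturedTorus Φ)) : ComplexTorus Φ)) :=
    isOpenEmbedding_coe_imm D
  obtain ⟨f, hu, hf⟩ := D.cov_finiteEtale.isCoveringMap.isLocalHomeomorph u
  refine ⟨(fun u : D.U => ((D.imm u : ↥(puncturedTorus Φ)) : ComplexTorus Φ)) '' f.source,
    he.isOpenMap _ f.open_source, ⟨u, hu, rfl⟩, ?_⟩
  rintro _ ⟨a, ha, rfl⟩ _ ⟨b, hb, rfl⟩ hab
  rw [extend_cov_apply_imm, extend_cov_apply_imm] at hab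
  have hab' : D.cov a = D.cov b := Subtype.ext hab
  rw [hf] at hab'
  rw [f.injOn ha hb hab']

end Diagram

end HolomorphicEllipticCuspidalization

end Literature.AnabelianGeometry.AbsoluteAnabelian
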